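import Literature.NumberTheory.Automorphic.UnitaryGroupTruncatedTraceClassUnipotentUnfoldTwo
import Literature.NumberTheory.Automorphic.UnitaryGroupUnipotentTruncatedTracePolynomial
import Literature.NumberTheory.Automorphic.UnitaryGroupTruncatedKernelClassIntegrableHoldsTwo
import Literature.NumberTheory.Automorphic.AdelicUnitaryGroupUnimodularQuasiSplit
import HarnessLib

/-!
# Assembly of the unipotent term of `U(J₂)`: `J^T_𝔬(f) = A·log T + B` for `T ≫ 0` at the central class `𝔬 = z·𝒰(F)`,
# from the unfolded form and the evaluation of the line bracket; the class polynomial `p_𝔬 = A·X + B`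
(Rogawski, *Automorphic Representations of Unitary Groups in Three Variables* (1990), Prop. 7.3.1 (p. 97): for `G = U(2)`,
`U(2) × U(1)` and `γ ∈ Z`, `J^T_G(𝔬, f)` is the sum of the terms (a)–(d), linear in `log T`; Arthur, *The trace formula in
invariant form*, Ann. of Math. 114 (1981), Prop. 2.3: `J^T_𝔬(f)` is a polynomial in `log T` and `J_𝔬(f)` is its constant term.)

Topic `NumberTheory/Automorphic`; namespace `Literature.NumberTheory.Automorphic.UnitaryGroup`. THEOREMS ONLY (no definition,
no named fact, no instance, no notation, no `sorry`). H-side copy at `N = 2` (cell `pub/hodgecm-mathlib`, crux H413, census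
`CENSUS-LAWS-Hside` §3 (σ-u)) of ★ (F) `UnitaryGroupUnipotentTruncatedTracePolynomial` §1–§2 (B-p17 (g19)), HYPOTHESES-FIRST
in the ONE analytic evaluation of the print at `N = 2` — there is no centre-lattice ∕ Heisenberg split on `U(J₂)`: the unipotent
radical IS the line `N(𝔸) ≅ 𝔸_E⁻`, so the whole bracket `ψ_T(g) = Σ'_{u ∈ N(F), u ≠ 1} f(g⁻¹ z₁ u g) − 1_{T < H(g)} K_{B,𝔬}(g,g)`
is ONE Tate integral at `|·|¹` (★ `UnitaryGroupLineTorusPushTwo` ⇒ `𝔄 log T + 𝔅`):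

* (E) the evaluation `∫_G β ψ_T dν_G = A·log T + B` for `T ≫ 0`, TOGETHER with the integrability of `β • ψ_T` (from which
  B1_two's `hint` is READ OFF: `‖(β g).toReal • ψ_T g‖ₑ = β g · ‖ψ_T g‖ₑ` since `β ≤ 1`);
* the integrability `hkint` of `k^T_𝔬` on `X` (the LAW-1∕3 class row at `N = 2`; hypotheses-first here).

OUTPUT: **`truncatedTraceClass_central_eq_linear_of_parts_two`** — `J^T_𝔬(f) = (c_μ A)·log T + (μ(X)·f(z₁) + c_μ B)` for `T ≫ 0`
(★ B1_two `truncatedTraceClass_central_eq_add_mul_integral_two` with `hsum` by ★ `summable_kernel_of_hasCompactSupport`); hence, by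
★ `classPolynomial_eq_and_eval_zero_eq_of_exists_linear` (every `N`), every polynomial computing `J^T_𝔬(f)` at `log T` for `T ≫ 0`
is `C (c_μ A)·X + C (μ(X)·f(z₁) + c_μ B)` with constant term THE UNIPOTENT TERM `μ(X)·f(z₁) + c_μ B` —
**`classPolynomial_central_eq_of_parts_two`**; §3 (edition 2) **`truncatedTraceClass_central_eq_linear_cm_of_parts_two`** — the same at the CM
pin with `hkint` DISCHARGED (★ `truncatedKernelClassIntegrable_cm_two`) and `ν_G` any Haar measure (★ `isMulRightInvariant_quasiSplit_cm_two`).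

HC_CM is proved only modulo the printed citations until rung 0 closes — nothing here bears on a summit statement.

## References

* J. D. Rogawski, *Automorphic Representations of Unitary Groups in Three Variables*, Annals of Mathematics Studies 123 (1990),
  Prop. 7.3.1 (p. 97), Prop. 7.3.2 (pp. 96–97), §2.2–2.3 (pp. 13–14) [Rogawski1990].
* J. Arthur, *The trace formula in invariant form*, Ann. of Math. 114 (1981), Prop. 2.3 [Arthur1981TraceFormulaInvariantForm].
* J. Arthur, *A trace formula for reductive groups I*, Duke Math. J. 45 (1978), Thm. 7.1, §8 [Arthur1978TraceFormulaI].
-/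

set_option autoImplicit false

noncomputable section

open MeasureTheory Measure NumberField IsDedekindDomain Set Polynomial Literature.MeasureTheory.Group
open scoped MatrixGroups NNReal ENNReal

namespace Literature.NumberTheory.Automorphic

namespace UnitaryGroup

variable {F E : Type} [Field F] [NumberField F] [Field E] [NumberField E] [Algebra F E]
  {c : E ≃ₐ[F] E} {ι : Type*}

variable (ζ : ratOne F E c) {z₁ : (quasiSplit F E c 2).arithmeticSubgroup}
  [MeasurableSpace (adelicUnipotent F E c 2)] [BorelSpace (adelicUnipotent F E c 2)]
  [MeasurableSpace (quasiSplit F E c 2).Adelic] [BorelSpace (quasiSplit F E c 2).Adelic]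

omit [MeasurableSpace (adelicUnipotent F E c 2)] [BorelSpace (adelicUnipotent F E c 2)] [BorelSpace (quasiSplit F E c 2).Adelic] in
/-- `∫⁻ β ‖ψ‖ₑ < ∞` is READ OFF the Bochner integrability of `β • ψ` for a covering weight `β ≤ 1`
(`‖(β g).toReal • ψ g‖ₑ = β g · ‖ψ g‖ₑ`). [cite: Arthur1978TraceFormulaI, §8] -/
theorem lintegral_weight_mul_enorm_lt_top_of_integrable_smul (νG : Measure (quasiSplit F E c 2).Adelic)
    {β : (quasiSplit F E c 2).Adelic → ℝ≥0∞}
    (hβ : IsCoveringWeight ((arithmeticBorel F E c 2).map (quasiSplit F E c 2).arithmeticSubgroup.subtype) β)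
    {ψ : (quasiSplit F E c 2).Adelic → ℂ} (hI : Integrable (fun g => (β g).toReal • ψ g) νG) :
    ∫⁻ g, β g * ‖ψ g‖ₑ ∂νG < ∞ := by
  have hβtop : ∀ z, β z ≠ ∞ := fun z => ne_top_of_le_ne_top ENNReal.one_ne_top (hβ.le_one z)
  have h := hI.2
  rw [HasFiniteIntegral] at h
  refine lt_of_le_of_lt (le_of_eq (lintegral_congr fun g => ?_)) h
  rw [enorm_smul, Real.enorm_eq_ofReal ENNReal.toReal_nonneg, ENNReal.ofReal_toReal (hβtop g)]

/-- **ASSEMBLY OF THE UNIPOTENT TERM OF `U(J₂)` (hypotheses-first).** For `f ∈ C_c(G(𝔸_F))`, an automorphic measure `μ`,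
an inversion-invariant Haar measure `ν_G`, a covering weight `β` of `B(F)♯`, GIVEN (i) the integrability of `k^T_𝔬` on `X` for
`T ≫ 0` and (ii) for `T ≫ 0` the integrability of `β • ψ_T` with `∫_G β ψ_T dν_G = A·log T + B` (the whole line bracket, ONE Tate
integral at `N = 2`): there is `T₂` with `J^T_𝔬(f) = (c_μ A)·log T + (μ(X)·f(z₁) + c_μ B)` for all `T > T₂` — [Rogawski1990,
Prop. 7.3.1]: (a) `= μ(X) f(z₁)`, (b)+(c)+(d) `= c_μ (A log T + B)`. ★ B1_two `truncatedTraceClass_central_eq_add_mul_integral_two`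
with `hsum` (★ `summable_kernel_of_hasCompactSupport`) and `hint` (from (ii)) discharged.
[cite: Rogawski1990, Prop. 7.3.1 (p. 97)] [cite: Arthur1978TraceFormulaI, §8] -/
theorem truncatedTraceClass_central_eq_linear_of_parts_two {cl : (quasiSplit F E c 2).arithmeticSubgroup → ι}
    (hc : c * c = 1) (hc1 : c ≠ 1)
    (hz₁ : (z₁ : (quasiSplit F E c 2).Adelic) =
      (quasiSplit F E c 2).toAdelic (ratCenter F E c 2 ((StdForm.antidiagonal 2).over E) ζ))
    {i : ι} (hcl : ∀ γ : (quasiSplit F E c 2).arithmeticSubgroup, cl γ = i ↔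
      ((adelicVal F E c 2 _ (γ : (quasiSplit F E c 2).Adelic) : GL (Fin 2) (AdeleRing (𝓞 E) E)) :
          Matrix (Fin 2) (Fin 2) (AdeleRing (𝓞 E) E)).charpoly =
        ((X - C ((ζ : Eˣ) : E)) ^ 2).map (algebraMap E (AdeleRing (𝓞 E) E)))
    (hclN : IsUnipotentInvariantOnBorel F E c 2 cl)
    (ν : Measure (adelicUnipotent F E c 2)) [ν.IsHaarMeasure]
    {𝓕 : Set (adelicUnipotent F E c 2)} (h𝓕 : IsFundamentalDomain (rationalUnipotent F E c 2) 𝓕 ν)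
    {f : (quasiSplit F E c 2).Adelic → ℂ} (hfc : Continuous f) (hf : HasCompactSupport f)
    (μ : Measure (quasiSplit F E c 2).automorphicQuotient) [(quasiSplit F E c 2).IsAutomorphicMeasure μ]
    (νG : Measure (quasiSplit F E c 2).Adelic) [νG.IsHaarMeasure] [νG.IsInvInvariant]
    {β : (quasiSplit F E c 2).Adelic → ℝ≥0∞}
    (hβ : IsCoveringWeight ((arithmeticBorel F E c 2).map (quasiSplit F E c 2).arithmeticSubgroup.subtype) β)
    (hkint : ∃ T₀ : ℝ≥0, ∀ T : ℝ≥0, T₀ < T →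
      Integrable ((quasiSplit F E c 2).quotFun (truncatedKernelClass ν 𝓕 T cl i f)) μ)
    {A B : ℂ}
    (hE : ∃ T₁ : ℝ≥0, ∀ T : ℝ≥0, T₁ < T →
      Integrable (fun g => (β g).toReal • ((∑' u : {u : rationalUnipotent F E c 2 // u ≠ 1},
        f (g⁻¹ * ((z₁ * ⟨(((u.1 : rationalUnipotent F E c 2) : adelicUnipotent F E c 2) :
          (quasiSplit F E c 2).Adelic), (u.1 : rationalUnipotent F E c 2).2⟩ :
            (quasiSplit F E c 2).arithmeticSubgroup) : (quasiSplit F E c 2).Adelic) * g)) -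
        kernelBorelTailClass ν 𝓕 T cl i f g)) νG ∧
      ∫ g, (β g).toReal • ((∑' u : {u : rationalUnipotent F E c 2 // u ≠ 1},
        f (g⁻¹ * ((z₁ * ⟨(((u.1 : rationalUnipotent F E c 2) : adelicUnipotent F E c 2) :
          (quasiSplit F E c 2).Adelic), (u.1 : rationalUnipotent F E c 2).2⟩ :
            (quasiSplit F E c 2).arithmeticSubgroup) : (quasiSplit F E c 2).Adelic) * g)) -
        kernelBorelTailClass ν 𝓕 T cl i f g) ∂νG = A * ((Real.log (T : ℝ) : ℝ) : ℂ) + B) :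
    haveI := t2Space_adeleRing_of_numberField E
    haveI := locallyCompactSpace_adeleRing' E
    haveI := secondCountableTopology_adeleRing E
    haveI : T2Space (quasiSplit F E c 2).Adelic :=
      inferInstanceAs (T2Space (adelic F E c 2 ((StdForm.antidiagonal 2).over E)))
    haveI : LocallyCompactSpace (quasiSplit F E c 2).Adelic :=
      inferInstanceAs (LocallyCompactSpace (adelic F E c 2 ((StdForm.antidiagonal 2).over E)))
    haveI : SecondCountableTopology (quasiSplit F E c 2).Adelic :=
      inferInstanceAs (SecondCountableTopology (adelic F E c 2 ((StdForm.antidiagonal 2).over E)))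
    haveI : DiscreteTopology (quasiSplit F E c 2).quotientSubgroup := by
      rw [quotientSubgroup_quasiSplit]; exact isDiscreteRational_quasiSplit
    letI := AdelicGroupData.measurableSpaceQuotientForm (quasiSplit F E c 2)
    haveI := AdelicGroupData.borelSpaceQuotientForm (quasiSplit F E c 2)
    haveI := AdelicGroupData.smulInvariantMeasureQuotientForm (quasiSplit F E c 2) μ
    haveI := AdelicGroupData.isFiniteMeasureOnCompactsQuotientForm (quasiSplit F E c 2) μ
    ∃ T₂ : ℝ≥0, ∀ T : ℝ≥0, T₂ < T →
      truncatedTraceClass μ ν 𝓕 T cl i f =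
        ((unfoldingConstant (quasiSplit F E c 2).quotientSubgroup
            (count : Measure (quasiSplit F E c 2).quotientSubgroup) μ νG : ℝ) : ℂ) * A *
            ((Real.log (T : ℝ) : ℝ) : ℂ) +
          ((μ.real Set.univ : ℝ) • f (z₁ : (quasiSplit F E c 2).Adelic) +
            ((unfoldingConstant (quasiSplit F E c 2).quotientSubgroup
              (count : Measure (quasiSplit F E c 2).quotientSubgroup) μ νG : ℝ) : ℂ) * B) := by
  haveI := t2Space_adeleRing_of_numberField E
  haveI := locallyCompactSpace_adeleRing' E
  haveI := secondCountableTopology_adeleRing E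
  haveI : T2Space (quasiSplit F E c 2).Adelic :=
    inferInstanceAs (T2Space (adelic F E c 2 ((StdForm.antidiagonal 2).over E)))
  haveI : LocallyCompactSpace (quasiSplit F E c 2).Adelic :=
    inferInstanceAs (LocallyCompactSpace (adelic F E c 2 ((StdForm.antidiagonal 2).over E)))
  haveI : SecondCountableTopology (quasiSplit F E c 2).Adelic :=
    inferInstanceAs (SecondCountableTopology (adelic F E c 2 ((StdForm.antidiagonal 2).over E)))
  haveI : DiscreteTopology (quasiSplit F E c 2).quotientSubgroup := by
    rw [quotientSubgroup_quasiSplit]; exact isDiscreteRational_quasiSplit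
  letI := AdelicGroupData.measurableSpaceQuotientForm (quasiSplit F E c 2)
  haveI := AdelicGroupData.borelSpaceQuotientForm (quasiSplit F E c 2)
  haveI := AdelicGroupData.smulInvariantMeasureQuotientForm (quasiSplit F E c 2) μ
  haveI := AdelicGroupData.isFiniteMeasureOnCompactsQuotientForm (quasiSplit F E c 2) μ
  obtain ⟨T₀, hT₀⟩ := hkint
  obtain ⟨T₁, hT₁⟩ := hE
  refine ⟨max T₀ T₁, fun T hT => ?_⟩
  have hT0 : T₀ < T := lt_of_le_of_lt (le_max_left _ _) hT
  have hT1 : T₁ < T := lt_of_le_of_lt (le_max_right _ _) hT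
  have hTpos : 0 < T := pos_of_gt hT
  -- B1's two binders: the class sum is a finite sum; the bracket is absolutely integrable by (ii)
  have hsum : ∀ x : (quasiSplit F E c 2).Adelic, Summable fun γ : cl ⁻¹' {i} =>
      f (x⁻¹ * (((γ : cl ⁻¹' {i}) : (quasiSplit F E c 2).arithmeticSubgroup) : (quasiSplit F E c 2).Adelic) * x) :=
    fun x => (summable_kernel_of_hasCompactSupport hf x x).subtype _
  obtain ⟨hEi, hEv⟩ := hT₁ T hT1
  have hint := lintegral_weight_mul_enorm_lt_top_of_integrable_smul νG hβ hEi
  rw [truncatedTraceClass_central_eq_add_mul_integral_two ζ hc hc1 hz₁ hcl hclN ν h𝓕 hTpos hfc hf μ νG hβ hsum hint, hEv]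
  ring

/-- **THE CLASS POLYNOMIAL OF THE UNIPOTENT CLASS OF `U(J₂)`**: under the hypotheses of
`truncatedTraceClass_central_eq_linear_of_parts_two`, every polynomial `p` computing `J^T_𝔬(f)` at `log T` for `T > T₀`
(the LAW-3 class row ∕ the socket's `P i`) is `C (c_μ A)·X + C (μ(X)·f(z₁) + c_μ B)`, with constant term THE UNIPOTENT TERM
`p(0) = μ(X)·f(z₁) + c_μ B` and `p.coeff 1 = c_μ A` (★ `classPolynomial_eq_and_eval_zero_eq_of_exists_linear`, every `N`).
[cite: Arthur1981TraceFormulaInvariantForm, Prop. 2.3] [cite: Rogawski1990, Prop. 7.3.1 (p. 97)] -/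
theorem classPolynomial_central_eq_of_parts_two {cl : (quasiSplit F E c 2).arithmeticSubgroup → ι}
    (hc : c * c = 1) (hc1 : c ≠ 1)
    (hz₁ : (z₁ : (quasiSplit F E c 2).Adelic) =
      (quasiSplit F E c 2).toAdelic (ratCenter F E c 2 ((StdForm.antidiagonal 2).over E) ζ))
    {i : ι} (hcl : ∀ γ : (quasiSplit F E c 2).arithmeticSubgroup, cl γ = i ↔
      ((adelicVal F E c 2 _ (γ : (quasiSplit F E c 2).Adelic) : GL (Fin 2) (AdeleRing (𝓞 E) E)) :
          Matrix (Fin 2) (Fin 2) (AdeleRing (𝓞 E) E)).charpoly =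
        ((X - C ((ζ : Eˣ) : E)) ^ 2).map (algebraMap E (AdeleRing (𝓞 E) E)))
    (hclN : IsUnipotentInvariantOnBorel F E c 2 cl)
    (ν : Measure (adelicUnipotent F E c 2)) [ν.IsHaarMeasure]
    {𝓕 : Set (adelicUnipotent F E c 2)} (h𝓕 : IsFundamentalDomain (rationalUnipotent F E c 2) 𝓕 ν)
    {f : (quasiSplit F E c 2).Adelic → ℂ} (hfc : Continuous f) (hf : HasCompactSupport f)
    (μ : Measure (quasiSplit F E c 2).automorphicQuotient) [(quasiSplit F E c 2).IsAutomorphicMeasure μ]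
    (νG : Measure (quasiSplit F E c 2).Adelic) [νG.IsHaarMeasure] [νG.IsInvInvariant]
    {β : (quasiSplit F E c 2).Adelic → ℝ≥0∞}
    (hβ : IsCoveringWeight ((arithmeticBorel F E c 2).map (quasiSplit F E c 2).arithmeticSubgroup.subtype) β)
    (hkint : ∃ T₀ : ℝ≥0, ∀ T : ℝ≥0, T₀ < T →
      Integrable ((quasiSplit F E c 2).quotFun (truncatedKernelClass ν 𝓕 T cl i f)) μ)
    {A B : ℂ}
    (hE : ∃ T₁ : ℝ≥0, ∀ T : ℝ≥0, T₁ < T →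
      Integrable (fun g => (β g).toReal • ((∑' u : {u : rationalUnipotent F E c 2 // u ≠ 1},
        f (g⁻¹ * ((z₁ * ⟨(((u.1 : rationalUnipotent F E c 2) : adelicUnipotent F E c 2) :
          (quasiSplit F E c 2).Adelic), (u.1 : rationalUnipotent F E c 2).2⟩ :
            (quasiSplit F E c 2).arithmeticSubgroup) : (quasiSplit F E c 2).Adelic) * g)) -
        kernelBorelTailClass ν 𝓕 T cl i f g)) νG ∧
      ∫ g, (β g).toReal • ((∑' u : {u : rationalUnipotent F E c 2 // u ≠ 1},
        f (g⁻¹ * ((z₁ * ⟨(((u.1 : rationalUnipotent F E c 2) : adelicUnipotent F E c 2) :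
          (quasiSplit F E c 2).Adelic), (u.1 : rationalUnipotent F E c 2).2⟩ :
            (quasiSplit F E c 2).arithmeticSubgroup) : (quasiSplit F E c 2).Adelic) * g)) -
        kernelBorelTailClass ν 𝓕 T cl i f g) ∂νG = A * ((Real.log (T : ℝ) : ℝ) : ℂ) + B)
    {p : ℂ[X]} {T₀' : ℝ≥0}
    (hP : ∀ T : ℝ≥0, T₀' < T → truncatedTraceClass μ ν 𝓕 T cl i f = p.eval ((Real.log (T : ℝ) : ℝ) : ℂ)) :
    haveI := t2Space_adeleRing_of_numberField E
    haveI := locallyCompactSpace_adeleRing' E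
    haveI := secondCountableTopology_adeleRing E
    haveI : T2Space (quasiSplit F E c 2).Adelic :=
      inferInstanceAs (T2Space (adelic F E c 2 ((StdForm.antidiagonal 2).over E)))
    haveI : LocallyCompactSpace (quasiSplit F E c 2).Adelic :=
      inferInstanceAs (LocallyCompactSpace (adelic F E c 2 ((StdForm.antidiagonal 2).over E)))
    haveI : SecondCountableTopology (quasiSplit F E c 2).Adelic :=
      inferInstanceAs (SecondCountableTopology (adelic F E c 2 ((StdForm.antidiagonal 2).over E)))
    haveI : DiscreteTopology (quasiSplit F E c 2).quotientSubgroup := by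
      rw [quotientSubgroup_quasiSplit]; exact isDiscreteRational_quasiSplit
    letI := AdelicGroupData.measurableSpaceQuotientForm (quasiSplit F E c 2)
    haveI := AdelicGroupData.borelSpaceQuotientForm (quasiSplit F E c 2)
    haveI := AdelicGroupData.smulInvariantMeasureQuotientForm (quasiSplit F E c 2) μ
    haveI := AdelicGroupData.isFiniteMeasureOnCompactsQuotientForm (quasiSplit F E c 2) μ
    p = C (((unfoldingConstant (quasiSplit F E c 2).quotientSubgroup
            (count : Measure (quasiSplit F E c 2).quotientSubgroup) μ νG : ℝ) : ℂ) * A) * X +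
        C ((μ.real Set.univ : ℝ) • f (z₁ : (quasiSplit F E c 2).Adelic) +
          ((unfoldingConstant (quasiSplit F E c 2).quotientSubgroup
            (count : Measure (quasiSplit F E c 2).quotientSubgroup) μ νG : ℝ) : ℂ) * B) ∧
      p.eval 0 = (μ.real Set.univ : ℝ) • f (z₁ : (quasiSplit F E c 2).Adelic) +
          ((unfoldingConstant (quasiSplit F E c 2).quotientSubgroup
            (count : Measure (quasiSplit F E c 2).quotientSubgroup) μ νG : ℝ) : ℂ) * B ∧
      p.coeff 1 = ((unfoldingConstant (quasiSplit F E c 2).quotientSubgroup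
            (count : Measure (quasiSplit F E c 2).quotientSubgroup) μ νG : ℝ) : ℂ) * A := by
  haveI := t2Space_adeleRing_of_numberField E
  haveI := locallyCompactSpace_adeleRing' E
  haveI := secondCountableTopology_adeleRing E
  haveI : T2Space (quasiSplit F E c 2).Adelic :=
    inferInstanceAs (T2Space (adelic F E c 2 ((StdForm.antidiagonal 2).over E)))
  haveI : LocallyCompactSpace (quasiSplit F E c 2).Adelic :=
    inferInstanceAs (LocallyCompactSpace (adelic F E c 2 ((StdForm.antidiagonal 2).over E)))
  haveI : SecondCountableTopology (quasiSplit F E c 2).Adelic :=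
    inferInstanceAs (SecondCountableTopology (adelic F E c 2 ((StdForm.antidiagonal 2).over E)))
  haveI : DiscreteTopology (quasiSplit F E c 2).quotientSubgroup := by
    rw [quotientSubgroup_quasiSplit]; exact isDiscreteRational_quasiSplit
  letI := AdelicGroupData.measurableSpaceQuotientForm (quasiSplit F E c 2)
  haveI := AdelicGroupData.borelSpaceQuotientForm (quasiSplit F E c 2)
  haveI := AdelicGroupData.smulInvariantMeasureQuotientForm (quasiSplit F E c 2) μ
  haveI := AdelicGroupData.isFiniteMeasureOnCompactsQuotientForm (quasiSplit F E c 2) μ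
  obtain ⟨T₂, hT₂⟩ := truncatedTraceClass_central_eq_linear_of_parts_two ζ hc hc1 hz₁ hcl hclN ν h𝓕 hfc hf μ νG hβ hkint hE
  exact classPolynomial_eq_and_eval_zero_eq_of_exists_linear hP ⟨T₂, hT₂⟩

/-! ## §3 (edition 2) At the CM pin `(L⁺, L, complexConj)`: `hkint` discharged -/

/-- **ASSEMBLY OF THE UNIPOTENT TERM FOR THE QUASI-SPLIT `U(J₂)` OF A CM FIELD** — §1 at the CM pair `(L⁺, L, complexConj)`
for a TEST function `f` (★ `IsQuasiSplitTest`), a conjugation-invariant `N(F)`-saturated class map `cl` with central fibre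
`cl⁻¹{i} = {charpoly = (X − z)²}`, and ANY Haar measure `ν_G` of `G(𝔸)` (two-sided: ★ `isMulRightInvariant_quasiSplit_cm_two`):
the LAW-3 integrability `hkint` of §1 is DISCHARGED by ★ `truncatedKernelClassIntegrable_cm_two` (B-p08 (g21)); what remains is
the ONE evaluation `hE` of [Rogawski1990, Prop. 7.3.1] (b)+(c)+(d). Conclusion: `J^T_𝔬(f) = (c_μ A)·log T + (μ(X)·f(z₁) + c_μ B)`
for `T ≫ 0`. (The `N = 2` twin of ★ `truncatedTraceClass_central_eq_linear_cm_of_parts`.)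
[cite: Rogawski1990, Prop. 7.3.1 (p. 97)] [cite: Arthur1978TraceFormulaI, Thm. 7.1, §8] -/
theorem truncatedTraceClass_central_eq_linear_cm_of_parts_two (L : Type) [Field L] [NumberField L] [IsCMField L]
    [MeasurableSpace (adelicUnipotent (↥(maximalRealSubfield L)) L (IsCMField.complexConj L) 2)]
    [BorelSpace (adelicUnipotent (↥(maximalRealSubfield L)) L (IsCMField.complexConj L) 2)]
    [MeasurableSpace (quasiSplit (↥(maximalRealSubfield L)) L (IsCMField.complexConj L) 2).Adelic]
    [BorelSpace (quasiSplit (↥(maximalRealSubfield L)) L (IsCMField.complexConj L) 2).Adelic]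
    (ζ : ratOne (↥(maximalRealSubfield L)) L (IsCMField.complexConj L))
    {z₁ : (quasiSplit (↥(maximalRealSubfield L)) L (IsCMField.complexConj L) 2).arithmeticSubgroup}
    (hz₁ : (z₁ : (quasiSplit (↥(maximalRealSubfield L)) L (IsCMField.complexConj L) 2).Adelic) =
      (quasiSplit (↥(maximalRealSubfield L)) L (IsCMField.complexConj L) 2).toAdelic
        (ratCenter (↥(maximalRealSubfield L)) L (IsCMField.complexConj L) 2 ((StdForm.antidiagonal 2).over L) ζ))
    {cl : (quasiSplit (↥(maximalRealSubfield L)) L (IsCMField.complexConj L) 2).arithmeticSubgroup → ι}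
    (hcl' : IsConjInvariant cl)
    {i : ι} (hcl : ∀ γ : (quasiSplit (↥(maximalRealSubfield L)) L (IsCMField.complexConj L) 2).arithmeticSubgroup,
      cl γ = i ↔
      ((adelicVal (↥(maximalRealSubfield L)) L (IsCMField.complexConj L) 2 _
            (γ : (quasiSplit (↥(maximalRealSubfield L)) L (IsCMField.complexConj L) 2).Adelic) :
            GL (Fin 2) (AdeleRing (𝓞 L) L)) : Matrix (Fin 2) (Fin 2) (AdeleRing (𝓞 L) L)).charpoly =
        ((X - C ((ζ : Lˣ) : L)) ^ 2).map (algebraMap L (AdeleRing (𝓞 L) L)))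
    (hclN : IsUnipotentInvariantOnBorel (↥(maximalRealSubfield L)) L (IsCMField.complexConj L) 2 cl)
    (ν : Measure (adelicUnipotent (↥(maximalRealSubfield L)) L (IsCMField.complexConj L) 2)) [ν.IsHaarMeasure]
    {𝓕 : Set (adelicUnipotent (↥(maximalRealSubfield L)) L (IsCMField.complexConj L) 2)}
    (h𝓕 : IsFundamentalDomain (rationalUnipotent (↥(maximalRealSubfield L)) L (IsCMField.complexConj L) 2) 𝓕 ν)
    {f : (quasiSplit (↥(maximalRealSubfield L)) L (IsCMField.complexConj L) 2).Adelic → ℂ}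
    (hf : IsQuasiSplitTest (↥(maximalRealSubfield L)) L (IsCMField.complexConj L) 2 f)
    (μ : Measure (quasiSplit (↥(maximalRealSubfield L)) L (IsCMField.complexConj L) 2).automorphicQuotient)
    [(quasiSplit (↥(maximalRealSubfield L)) L (IsCMField.complexConj L) 2).IsAutomorphicMeasure μ]
    (νG : Measure (quasiSplit (↥(maximalRealSubfield L)) L (IsCMField.complexConj L) 2).Adelic) [νG.IsHaarMeasure]
    {β : (quasiSplit (↥(maximalRealSubfield L)) L (IsCMField.complexConj L) 2).Adelic → ℝ≥0∞}
    (hβ : IsCoveringWeight ((arithmeticBorel (↥(maximalRealSubfield L)) L (IsCMField.complexConj L) 2).map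
      (quasiSplit (↥(maximalRealSubfield L)) L (IsCMField.complexConj L) 2).arithmeticSubgroup.subtype) β)
    {A B : ℂ}
    (hE : ∃ T₁ : ℝ≥0, ∀ T : ℝ≥0, T₁ < T →
      Integrable (fun g => (β g).toReal •
        ((∑' u : {u : rationalUnipotent (↥(maximalRealSubfield L)) L (IsCMField.complexConj L) 2 // u ≠ 1},
          f (g⁻¹ * ((z₁ * ⟨(((u.1 : rationalUnipotent (↥(maximalRealSubfield L)) L (IsCMField.complexConj L) 2) :
            adelicUnipotent (↥(maximalRealSubfield L)) L (IsCMField.complexConj L) 2) :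
            (quasiSplit (↥(maximalRealSubfield L)) L (IsCMField.complexConj L) 2).Adelic),
            (u.1 : rationalUnipotent (↥(maximalRealSubfield L)) L (IsCMField.complexConj L) 2).2⟩ :
              (quasiSplit (↥(maximalRealSubfield L)) L (IsCMField.complexConj L) 2).arithmeticSubgroup) :
              (quasiSplit (↥(maximalRealSubfield L)) L (IsCMField.complexConj L) 2).Adelic) * g)) -
          kernelBorelTailClass ν 𝓕 T cl i f g)) νG ∧
      ∫ g, (β g).toReal •
        ((∑' u : {u : rationalUnipotent (↥(maximalRealSubfield L)) L (IsCMField.complexConj L) 2 // u ≠ 1},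
          f (g⁻¹ * ((z₁ * ⟨(((u.1 : rationalUnipotent (↥(maximalRealSubfield L)) L (IsCMField.complexConj L) 2) :
            adelicUnipotent (↥(maximalRealSubfield L)) L (IsCMField.complexConj L) 2) :
            (quasiSplit (↥(maximalRealSubfield L)) L (IsCMField.complexConj L) 2).Adelic),
            (u.1 : rationalUnipotent (↥(maximalRealSubfield L)) L (IsCMField.complexConj L) 2).2⟩ :
              (quasiSplit (↥(maximalRealSubfield L)) L (IsCMField.complexConj L) 2).arithmeticSubgroup) :
              (quasiSplit (↥(maximalRealSubfield L)) L (IsCMField.complexConj L) 2).Adelic) * g)) -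
          kernelBorelTailClass ν 𝓕 T cl i f g) ∂νG = A * ((Real.log (T : ℝ) : ℝ) : ℂ) + B) :
    haveI := t2Space_adeleRing_of_numberField L
    haveI := locallyCompactSpace_adeleRing' L
    haveI := secondCountableTopology_adeleRing L
    haveI : T2Space (quasiSplit (↥(maximalRealSubfield L)) L (IsCMField.complexConj L) 2).Adelic :=
      inferInstanceAs (T2Space (adelic (↥(maximalRealSubfield L)) L (IsCMField.complexConj L) 2
        ((StdForm.antidiagonal 2).over L)))
    haveI : LocallyCompactSpace (quasiSplit (↥(maximalRealSubfield L)) L (IsCMField.complexConj L) 2).Adelic :=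
      inferInstanceAs (LocallyCompactSpace (adelic (↥(maximalRealSubfield L)) L (IsCMField.complexConj L) 2
        ((StdForm.antidiagonal 2).over L)))
    haveI : SecondCountableTopology (quasiSplit (↥(maximalRealSubfield L)) L (IsCMField.complexConj L) 2).Adelic :=
      inferInstanceAs (SecondCountableTopology (adelic (↥(maximalRealSubfield L)) L (IsCMField.complexConj L) 2
        ((StdForm.antidiagonal 2).over L)))
    haveI : DiscreteTopology (quasiSplit (↥(maximalRealSubfield L)) L (IsCMField.complexConj L) 2).quotientSubgroup := by
      rw [quotientSubgroup_quasiSplit]; exact isDiscreteRational_quasiSplit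
    letI := AdelicGroupData.measurableSpaceQuotientForm (quasiSplit (↥(maximalRealSubfield L)) L (IsCMField.complexConj L) 2)
    haveI := AdelicGroupData.borelSpaceQuotientForm (quasiSplit (↥(maximalRealSubfield L)) L (IsCMField.complexConj L) 2)
    haveI := AdelicGroupData.smulInvariantMeasureQuotientForm
      (quasiSplit (↥(maximalRealSubfield L)) L (IsCMField.complexConj L) 2) μ
    haveI := AdelicGroupData.isFiniteMeasureOnCompactsQuotientForm
      (quasiSplit (↥(maximalRealSubfield L)) L (IsCMField.complexConj L) 2) μ
    ∃ T₂ : ℝ≥0, ∀ T : ℝ≥0, T₂ < T →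
      truncatedTraceClass μ ν 𝓕 T cl i f =
        ((unfoldingConstant (quasiSplit (↥(maximalRealSubfield L)) L (IsCMField.complexConj L) 2).quotientSubgroup
            (count : Measure (quasiSplit (↥(maximalRealSubfield L)) L (IsCMField.complexConj L) 2).quotientSubgroup)
            μ νG : ℝ) : ℂ) * A * ((Real.log (T : ℝ) : ℝ) : ℂ) +
          ((μ.real Set.univ : ℝ) • f (z₁ : (quasiSplit (↥(maximalRealSubfield L)) L (IsCMField.complexConj L) 2).Adelic) +
            ((unfoldingConstant (quasiSplit (↥(maximalRealSubfield L)) L (IsCMField.complexConj L) 2).quotientSubgroup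
              (count : Measure (quasiSplit (↥(maximalRealSubfield L)) L (IsCMField.complexConj L) 2).quotientSubgroup)
              μ νG : ℝ) : ℂ) * B) := by
  haveI := t2Space_adeleRing_of_numberField L
  haveI := locallyCompactSpace_adeleRing' L
  haveI := secondCountableTopology_adeleRing L
  haveI : T2Space (quasiSplit (↥(maximalRealSubfield L)) L (IsCMField.complexConj L) 2).Adelic :=
    inferInstanceAs (T2Space (adelic (↥(maximalRealSubfield L)) L (IsCMField.complexConj L) 2
      ((StdForm.antidiagonal 2).over L)))
  haveI : LocallyCompactSpace (quasiSplit (↥(maximalRealSubfield L)) L (IsCMField.complexConj L) 2).Adelic :=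
    inferInstanceAs (LocallyCompactSpace (adelic (↥(maximalRealSubfield L)) L (IsCMField.complexConj L) 2
      ((StdForm.antidiagonal 2).over L)))
  haveI : SecondCountableTopology (quasiSplit (↥(maximalRealSubfield L)) L (IsCMField.complexConj L) 2).Adelic :=
    inferInstanceAs (SecondCountableTopology (adelic (↥(maximalRealSubfield L)) L (IsCMField.complexConj L) 2
      ((StdForm.antidiagonal 2).over L)))
  haveI : νG.IsMulRightInvariant := isMulRightInvariant_quasiSplit_cm_two L νG
  haveI : νG.IsInvInvariant := isInvInvariant_of_isMulRightInvariant νG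
  exact truncatedTraceClass_central_eq_linear_of_parts_two ζ (complexConj_mul_complexConj L)
    (IsCMField.complexConj_ne_one L) hz₁ hcl hclN ν h𝓕 hf.continuous' hf.hasCompactSupport' μ νG hβ
    (truncatedKernelClassIntegrable_cm_two L hcl' hclN ν 𝓕 h𝓕 μ f hf i) hE

end UnitaryGroup

end Literature.NumberTheory.Automorphic
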